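import Mathlib
import HarnessLib
import Summits.ABC.ABC.Theses.DefiniteXi

/-!
# Sketch — crux-ideate stmt-ABC-15024 (SteinbergCore), ideator k = 1, round 1

First lemmas / typed transfer targets for the idea cards
`steinberg-linvariant-slice` and `orbit-uniform-index`.
Everything is stated over existing declarations (`brandtXi`, `freyCurve`,
`minimalDiscriminantNorm`, `conductorNorm`, route decl `SteinbergCore`).
-/

namespace Summit.ABC.ABC.Cruxes.SteinbergCore.Ideator1

open Literature.NumberTheory.EllipticCurves Literature.NumberTheory.Automorphic
open scoped BigOperators

/-- The quarantined congruence number ξ(E_(a,b); N/Nm, Nm) of the route. -/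
noncomputable def xi (a b : ℤ) (N Nm : ℕ) : ℕ :=
  brandtXi (N / Nm) Nm (fun n => (freyCurve a b).LFunction n)

/-- Tamagawa exponent c_q = v_q(Δ_min(E_(a,b))). -/
noncomputable def tamExp (a b : ℤ) (q : ℕ) : ℕ :=
  ((freyCurve a b).minimalDiscriminantNorm ℤ).factorization q

/-- `sixPart n = 2^{v₂ n} 3^{v₃ n}` and the prime-to-6 part, as in the route's `closes`. -/
def sixPart (n : ℕ) : ℕ := ordProj[2] n * ordProj[3] n
def coprimeSixPart (n : ℕ) : ℕ := n / sixPart n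

/-- WIEFERICH DEPTH OF THE TATE UNIT of the Frey curve at an odd prime `ℓ` dividing exactly one
of `a, b, a+b`: writing `x` for that member, `x'` for its `ℓ`-free part and `y` for another member,
the unit part of the Tate parameter is `(x'/(16y))² · (1 + O(ℓ^{v_ℓ x}))`, and its Wieferich depth is
`v_ℓ(x'^{ℓ-1} - (16y)^{ℓ-1}) - 1 ≥ 0` (Fermat quotients of the triple). -/
def tateWieferichDepth (ℓ : ℕ) (a b : ℤ) : ℕ :=
  let x : ℕ := if (ℓ : ℤ) ∣ a then a.natAbs else if (ℓ : ℤ) ∣ b then b.natAbs else (a + b).natAbs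
  let y : ℕ := if (ℓ : ℤ) ∣ a then b.natAbs else a.natAbs
  let x' : ℕ := x / ℓ ^ (x.factorization ℓ)
  padicValInt ℓ ((x' : ℤ) ^ (ℓ - 1) - ((16 * y : ℕ) : ℤ) ^ (ℓ - 1)) - 1

/-- The ON-LEVEL LEDGER exponent at a quarantined prime `ℓ ≥ 5`: `v_ℓ(c_ℓ) + W_ℓ + 1`
(valuation of the Tamagawa exponent + Wieferich depth of the Tate unit + 1). -/
noncomputable def ledgerExp (a b : ℤ) (ℓ : ℕ) : ℕ :=
  padicValNat ℓ (tamExp a b ℓ) + tateWieferichDepth ℓ a b + 1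

/-- Quarantined primes `≥ 5`. -/
noncomputable def onLevelPrimes (Nm : ℕ) : Finset ℕ := Nm.primeFactors.filter (5 ≤ ·)

/-- ON-LEVEL part of ξ: `∏_{ℓ ∣ Nm, ℓ ≥ 5} ℓ^{v_ℓ ξ}`. -/
noncomputable def onLevelPart (ξ Nm : ℕ) : ℕ := ∏ ℓ ∈ onLevelPrimes Nm, ordProj[ℓ] ξ

/-- ON-LEVEL part of ξ CAPPED by the ledger: `∏_{ℓ ∣ Nm, ℓ ≥ 5} ℓ^{min(v_ℓ ξ, v_ℓ(c_ℓ)+W_ℓ+1)}`. -/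
noncomputable def cappedOnLevelPart (a b : ℤ) (ξ Nm : ℕ) : ℕ :=
  ∏ ℓ ∈ onLevelPrimes Nm, ℓ ^ min (ξ.factorization ℓ) (ledgerExp a b ℓ)

/-- **SliceExcess** (card `steinberg-linvariant-slice`, the NEW content; not implied by abc).
At every quarantined prime `ℓ ≥ 5` the ℓ-adic depth of the Frey–Brandt eigenvector exceeds the
explicit ledger `v_ℓ(c_ℓ) + W_ℓ + 1` only by a total factor `≤ C_ε N^ε` — the conjectural
consequence of L-INVARIANT RIGIDITY (a congruence f_E ≡ g mod λⁿ with g ℓ-new forces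
𝓛(E) ≡ 𝓛(g) mod λ^{n - v(c_ℓ)}, and v_λ(𝓛(E_(a,b))) = W_ℓ + 1 − v_ℓ(c_ℓ) is explicit). -/
def SliceExcess : Prop :=
  ∀ ε : ℝ, 0 < ε → ∃ C : ℝ, ∀ a b : ℤ, IsCoprime a b → a * b * (a + b) ≠ 0 → ∀ (N : ℕ) [NeZero N],
    (freyCurve a b).conductorNorm ℤ = N → ∀ Nm : ℕ, Odd Nm → Squarefree Nm →
    Odd Nm.primeFactors.card → Nm ∣ N →
      ((onLevelPart (xi a b N Nm) Nm : ℕ) : ℝ)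
        ≤ C * (N : ℝ) ^ ε * ((cappedOnLevelPart a b (xi a b N Nm) Nm : ℕ) : ℝ)

/-- **LedgerCore** (the residual crux of the card; IMPLIED BY `SteinbergCore`, hence by abc):
SteinbergCore with the on-level depths replaced by their ledger-capped values. -/
def LedgerCore : Prop :=
  ∀ ε : ℝ, 0 < ε → ∃ C : ℝ, ∀ a b : ℤ, IsCoprime a b → a * b * (a + b) ≠ 0 → ∀ (N : ℕ) [NeZero N],
    (freyCurve a b).conductorNorm ℤ = N → ∀ Nm : ℕ, Odd Nm → Squarefree Nm →
    Odd Nm.primeFactors.card → Nm ∣ N →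
      ((coprimeSixPart (xi a b N Nm) / onLevelPart (xi a b N Nm) Nm : ℕ) : ℝ)
        * ((cappedOnLevelPart a b (xi a b N Nm) Nm : ℕ) : ℝ)
        * ((∏ q ∈ N.primeFactors, tamExp a b q : ℕ) : ℝ) ≤ C * (N : ℝ) ^ (2 + ε)

/-- The glue of the card (pure arithmetic on the pattern of `DefiniteXi.closes`, Step 1):
`SliceExcess ∧ LedgerCore ⟹ SteinbergCore`, because
`coprimeSixPart ξ = onLevelPart ξ · (coprimeSixPart ξ / onLevelPart ξ)` (distinct primes ≥ 5). -/
def SliceGlue : Prop :=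
  SliceExcess → LedgerCore → Summit.ABC.ABC.Theses.DefiniteXi.SteinbergCore

/-- Converse bookkeeping: `SteinbergCore ⟹ LedgerCore` (the capped on-level part divides the
true one), so `LedgerCore` is abc-implied and strictly an avatar of the OFF-LEVEL mass. -/
def LedgerCore_of_SteinbergCore : Prop :=
  Summit.ABC.ABC.Theses.DefiniteXi.SteinbergCore → LedgerCore

/-! ### Card `orbit-uniform-index`: the archimedean no-total-congruence lemma (rational core) -/

/-- Kronecker-type vanishing used by the card: an algebraic integer all of whose complex
conjugates have absolute value `< 1` is zero.  (Mathlib: norm is an integer of absolute value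
`< 1`.)  Stated here as the Prop the line leans on. -/
def SmallConjugatesVanish : Prop :=
  ∀ (K : Type) [Field K] [NumberField K] (x : NumberField.RingOfIntegers K),
    (∀ φ : K →+* ℂ, ‖φ (x : K)‖ < 1) → x = 0

/-- **UniformDepthBound** (provable now from `SmallConjugatesVanish` + the Sturm bound + linear
independence of Galois-conjugate newforms): an ORBIT-UNIFORM congruence between the integer
Frey eigen-system and a whole Galois orbit of eigen-systems — `a_n(f_E) ≡ a_n(g) (mod m·O_K)` for
all `n` — has `m ≤ 4·d(B)·√B`, `B` the Sturm bound of the level.  Typed abstractly over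
coefficient sequences: if the sequences agree mod `m·𝓞 K` for all `n ≤ B`, both obey the
Deligne-type bound `2 d(n) √n` in every complex embedding, and `m > 4 d(B) √B`, then they agree
up to `B`. -/
def UniformDepthBound : Prop :=
  ∀ (K : Type) [Field K] [NumberField K] (B m : ℕ) (a : ℕ → ℤ) (g : ℕ → NumberField.RingOfIntegers K),
    0 < m →
    (∀ n, 1 ≤ n → n ≤ B → ∃ y : NumberField.RingOfIntegers K, (a n : NumberField.RingOfIntegers K) - g n = m * y) →
    (∀ n, 1 ≤ n → n ≤ B → ∀ φ : K →+* ℂ, ‖φ ((g n : NumberField.RingOfIntegers K) : K)‖ ≤ 2 * (Nat.divisors n).card * Real.sqrt n) →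
    (∀ n, 1 ≤ n → n ≤ B → |(a n : ℝ)| ≤ 2 * (Nat.divisors n).card * Real.sqrt n) →
    (4 * (Nat.divisors B).card * Real.sqrt B < m) →
      ∀ n, 1 ≤ n → n ≤ B → (a n : NumberField.RingOfIntegers K) = g n

/-- **IndexFromUniformity** (the order-theoretic first lemma of `orbit-uniform-index`, provable
now): if every element of a subring `R` of the ring of integers of a number field of degree `d`
is congruent to a rational integer modulo `ℓ`, then `ℓ^{d-1}` divides the index of `R` — typed on
the additive groups. -/
def IndexFromUniformity : Prop :=
  ∀ (K : Type) [Field K] [NumberField K] (ℓ : ℕ), ℓ.Prime →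
    ∀ R : Subring (NumberField.RingOfIntegers K),
      (∀ x ∈ R, ∃ (z : ℤ) (y : NumberField.RingOfIntegers K), x = z + ℓ * y) →
      ℓ ^ (Module.finrank ℚ K - 1) ∣ R.toAddSubgroup.index

end Summit.ABC.ABC.Cruxes.SteinbergCore.Ideator1

/-! ### Kernel-checked glue for `steinberg-linvariant-slice` -/

namespace Glue

open Summit.ABC.ABC.Cruxes.SteinbergCore.Ideator1

theorem prime_of_mem_onLevelPrimes {Nm ℓ : ℕ} (h : ℓ ∈ onLevelPrimes Nm) : ℓ.Prime := by
  unfold onLevelPrimes at h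
  rw [Finset.mem_filter] at h
  exact Nat.prime_of_mem_primeFactors h.1

theorem five_le_of_mem_onLevelPrimes {Nm ℓ : ℕ} (h : ℓ ∈ onLevelPrimes Nm) : 5 ≤ ℓ := by
  unfold onLevelPrimes at h
  rw [Finset.mem_filter] at h
  exact h.2

/-- `∏_{ℓ ∈ S} ℓ^{v_ℓ ξ} ∣ ξ` for any finset `S` (terms off the support are `1`). -/
theorem prod_ordProj_dvd (ξ : ℕ) (S : Finset ℕ) :
    ∏ ℓ ∈ S, ordProj[ℓ] ξ ∣ ξ := by
  rcases Nat.eq_zero_or_pos ξ with h0 | hpos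
  · subst h0; exact dvd_zero _
  · have hself : ∏ p ∈ ξ.primeFactors, ordProj[p] ξ = ξ := by
      conv_rhs => rw [← Nat.factorization_prod_pow_eq_self hpos.ne']
      rw [Finsupp.prod, Nat.support_factorization]
    have hoff : ∀ x ∈ S, x ∉ S ∩ ξ.primeFactors → ordProj[x] ξ = 1 := by
      intro x hxS hxnot
      have hx : x ∉ ξ.primeFactors := fun h => hxnot (Finset.mem_inter.mpr ⟨hxS, h⟩)
      have : ξ.factorization x = 0 := by
        by_contra hne
        exact hx (by rw [← Nat.support_factorization]; exact Finsupp.mem_support_iff.mpr hne)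
      simp [this]
    calc ∏ ℓ ∈ S, ordProj[ℓ] ξ = ∏ ℓ ∈ S ∩ ξ.primeFactors, ordProj[ℓ] ξ :=
          (Finset.prod_subset Finset.inter_subset_left hoff).symm
      _ ∣ ∏ p ∈ ξ.primeFactors, ordProj[p] ξ :=
          Finset.prod_dvd_prod_of_subset _ _ _ Finset.inter_subset_right
      _ = ξ := hself

theorem onLevelPart_dvd_coprimeSixPart (ξ Nm : ℕ) :
    onLevelPart ξ Nm ∣ coprimeSixPart ξ := by
  unfold onLevelPart coprimeSixPart sixPart
  rcases Nat.eq_zero_or_pos ξ with h0 | hpos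
  · subst h0
    simp
  · apply Nat.dvd_div_of_mul_dvd
    -- (ordProj[2] ξ * ordProj[3] ξ) * ∏ ordProj[ℓ] ξ ∣ ξ : assemble the product over insert 2 (insert 3 S)
    have h2 : (2 : ℕ) ∉ insert 3 (onLevelPrimes Nm) := by
      rw [Finset.mem_insert]
      rintro (h | h)
      · norm_num at h
      · have := five_le_of_mem_onLevelPrimes h; omega
    have h3 : (3 : ℕ) ∉ onLevelPrimes Nm := by
      intro h; have := five_le_of_mem_onLevelPrimes h; omega
    have hall : ∀ ℓ ∈ insert 2 (insert 3 (onLevelPrimes Nm)), ℓ.Prime := by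
      intro ℓ hℓ
      rw [Finset.mem_insert, Finset.mem_insert] at hℓ
      rcases hℓ with rfl | rfl | h
      · exact Nat.prime_two
      · exact Nat.prime_three
      · exact prime_of_mem_onLevelPrimes h
    have key := prod_ordProj_dvd ξ (insert 2 (insert 3 (onLevelPrimes Nm)))
    rw [Finset.prod_insert h2, Finset.prod_insert h3, ← mul_assoc] at key
    exact key

/-- THE GLUE: `SliceExcess → LedgerCore → SteinbergCore` (pattern of `DefiniteXi.closes`, Step 1). -/
theorem sliceGlue : SliceGlue := by
  intro hS hL ε hε
  obtain ⟨C₁, hC₁⟩ := hS (ε / 2) (by linarith)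
  obtain ⟨C₂, hC₂⟩ := hL (ε / 2) (by linarith)
  refine ⟨max C₁ 0 * max C₂ 0, ?_⟩
  intro a b hab h0 N _ hN Nm hodd hsq hcard hdvd
  have hA' := hC₁ a b hab h0 N hN Nm hodd hsq hcard hdvd
  have hB' := hC₂ a b hab h0 N hN Nm hodd hsq hcard hdvd
  -- the goal is literally SteinbergCore's body; name its pieces
  change ((coprimeSixPart (xi a b N Nm) : ℕ) : ℝ)
      * ((∏ q ∈ N.primeFactors, tamExp a b q : ℕ) : ℝ) ≤ _
  set ξ : ℕ := xi a b N Nm with hξ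
  set on : ℕ := onLevelPart ξ Nm with hon
  set cap : ℕ := cappedOnLevelPart a b ξ Nm with hcap
  set P : ℕ := ∏ q ∈ N.primeFactors, tamExp a b q with hP
  have hNpos : (0 : ℝ) < (N : ℝ) := by exact_mod_cast Nat.pos_of_ne_zero (NeZero.ne N)
  have hdv : on ∣ coprimeSixPart ξ := onLevelPart_dvd_coprimeSixPart ξ Nm
  have hsplit : ((coprimeSixPart ξ : ℕ) : ℝ) = (on : ℝ) * ((coprimeSixPart ξ / on : ℕ) : ℝ) := by
    have : on * (coprimeSixPart ξ / on) = coprimeSixPart ξ := Nat.mul_div_cancel' hdv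
    exact_mod_cast this.symm
  have hc : (0 : ℝ) ≤ ((coprimeSixPart ξ / on : ℕ) : ℝ) := by positivity
  have hPnn : (0 : ℝ) ≤ (P : ℝ) := by positivity
  have hcapnn : (0 : ℝ) ≤ (cap : ℝ) := by positivity
  have hrpow1 : (0 : ℝ) ≤ (N : ℝ) ^ (ε / 2) := Real.rpow_nonneg hNpos.le _
  have hrpow2 : (0 : ℝ) ≤ (N : ℝ) ^ (2 + ε / 2) := Real.rpow_nonneg hNpos.le _
  have hC₁0 : (0 : ℝ) ≤ max C₁ 0 := le_max_right _ _
  have hC₂0 : (0 : ℝ) ≤ max C₂ 0 := le_max_right _ _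
  have hA'' : (on : ℝ) ≤ max C₁ 0 * (N : ℝ) ^ (ε / 2) * (cap : ℝ) := by
    refine le_trans hA' ?_
    gcongr
    exact le_max_left _ _
  have hB'' : ((coprimeSixPart ξ / on : ℕ) : ℝ) * (cap : ℝ) * (P : ℝ) ≤
      max C₂ 0 * (N : ℝ) ^ (2 + ε / 2) := by
    refine le_trans hB' ?_
    gcongr
    exact le_max_left _ _
  have hNsplit : (N : ℝ) ^ (ε / 2) * (N : ℝ) ^ (2 + ε / 2) = (N : ℝ) ^ (2 + ε) := by
    rw [← Real.rpow_add hNpos]; ring_nf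
  calc ((coprimeSixPart ξ : ℕ) : ℝ) * (P : ℝ)
      = (on : ℝ) * (((coprimeSixPart ξ / on : ℕ) : ℝ) * (P : ℝ)) := by rw [hsplit]; ring
    _ ≤ (max C₁ 0 * (N : ℝ) ^ (ε / 2) * (cap : ℝ)) * (((coprimeSixPart ξ / on : ℕ) : ℝ) * (P : ℝ)) := by
        gcongr
    _ = max C₁ 0 * (N : ℝ) ^ (ε / 2) * (((coprimeSixPart ξ / on : ℕ) : ℝ) * (cap : ℝ) * (P : ℝ)) := by
        ring
    _ ≤ max C₁ 0 * (N : ℝ) ^ (ε / 2) * (max C₂ 0 * (N : ℝ) ^ (2 + ε / 2)) := by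
        gcongr
    _ = max C₁ 0 * max C₂ 0 * (N : ℝ) ^ (2 + ε) := by rw [← hNsplit]; ring

/-- Converse: `SteinbergCore → LedgerCore` (capped on-level part ≤ true on-level part). -/
theorem ledgerCore_of_steinbergCore : LedgerCore_of_SteinbergCore := by
  intro hSC ε hε
  obtain ⟨C, hC⟩ := hSC ε hε
  refine ⟨max C 0, ?_⟩
  intro a b hab h0 N _ hN Nm hodd hsq hcard hdvd
  have h := hC a b hab h0 N hN Nm hodd hsq hcard hdvd
  change ((coprimeSixPart (xi a b N Nm) : ℕ) : ℝ)
      * ((∏ q ∈ N.primeFactors, tamExp a b q : ℕ) : ℝ) ≤ _ at h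
  set ξ : ℕ := xi a b N Nm with hξ
  set on : ℕ := onLevelPart ξ Nm with hon
  set cap : ℕ := cappedOnLevelPart a b ξ Nm with hcap
  set P : ℕ := ∏ q ∈ N.primeFactors, tamExp a b q with hP
  have hNpos : (0 : ℝ) < (N : ℝ) := by exact_mod_cast Nat.pos_of_ne_zero (NeZero.ne N)
  have hdv : on ∣ coprimeSixPart ξ := onLevelPart_dvd_coprimeSixPart ξ Nm
  -- cap ≤ on (termwise min ≤ left)
  have hcaple : cap ≤ on := by
    simp only [hcap, hon, cappedOnLevelPart, onLevelPart]
    apply Finset.prod_le_prod'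
    intro ℓ hℓ
    exact Nat.pow_le_pow_right (prime_of_mem_onLevelPrimes hℓ).pos (min_le_left _ _)
  have hmain : ((coprimeSixPart ξ / on : ℕ) : ℝ) * (cap : ℝ) ≤ ((coprimeSixPart ξ : ℕ) : ℝ) := by
    have : (coprimeSixPart ξ / on) * cap ≤ coprimeSixPart ξ := by
      calc (coprimeSixPart ξ / on) * cap ≤ (coprimeSixPart ξ / on) * on :=
            Nat.mul_le_mul_left _ hcaple
        _ = coprimeSixPart ξ := Nat.div_mul_cancel hdv
    exact_mod_cast this
  have hPnn : (0 : ℝ) ≤ (P : ℝ) := by positivity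
  calc ((coprimeSixPart ξ / on : ℕ) : ℝ) * (cap : ℝ) * (P : ℝ)
      ≤ ((coprimeSixPart ξ : ℕ) : ℝ) * (P : ℝ) := by gcongr
    _ ≤ C * (N : ℝ) ^ (2 + ε) := h
    _ ≤ max C 0 * (N : ℝ) ^ (2 + ε) := by
        gcongr
        exact le_max_left _ _

end Glue
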